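import Literature.MathematicalPhysics.QuantumFieldTheory.Balaban1983to89.B9SupplySockB9P3ZdInstance
import Literature.MathematicalPhysics.QuantumFieldTheory.Balaban1983to89.B9SupplySockB9P3ZdAt

/-!
# `Balaban1983to89.B9SupplySockB9P3ZdEmptyClass` — [Balaban1985BackgroundPropagators] p. 396 (the cube class of (3.35)) ∕ [Balaban1984PropagatorsII]
# (2.1)–(2.2) p. 224 AT THE `ℤᵈ` FRAME `B9SupplySockB9P3ZdFrame`: a LOCATED NEGATIVE about the member index — at every member `(M, i, m)` whose
# `Ω₀` lies in a box of side `< ⌈M⌉` the p. 396 CUBE CLASS IS EMPTY, so the frame's regularity class (3.35) holds for EVERY configuration (vacuously),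
# and n06-b's member-local curvature binder `B9SupplySockB9P3ZdAt.CurvAt` can then be met only by a letter `Δ′` that VANISHES on `E(Ω₀)` at every
# unitary background — print ties `M` to the geometry («Ω_j … unions of big blocks», (2.1)), the `ℤᵈ` member index does not

statement-level skeleton of published theorems with citation tags; proofs where landed; nothing here is a claim about the
Yang–Mills mass gap

`[Balaban1985BackgroundPropagators]` ("B9", CMP **99** (1985) 389–434) p. 396: *«Let us consider a class of cubes with the following properties: for
each cube □ of this class there exists a unique index j, 0 ≤ j ≤ k, such that □ ⊂ Bʲ(Λ_j) ∪ B^{j+1}(Λ_{j+1}), □ ∩ Bʲ(Λ_j) ≠ ∅, and □ is a union of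
several big blocks of the lattice T_{Lʲη}, which implies that its size in the lattice T_η is O(1)MLʲη»*, (3.35): *«for an arbitrary cube □ of the
described above class, and for a configuration U there exists a gauge transformation u on □ such that …»*; `[Balaban1984PropagatorsII]` ("B6", CMP
**96** (1984) 223–250) (2.1)–(2.2) p. 224: the domains `Ω_j` are unions of big blocks of size `M` and `(Lʲη)⁻¹dist(Ω_jᶜ, Ω_{j+1}) > RM`; [B9] p. 399:
*«the constants … depend on d, L only»* — for SEQUENCES `{Ω_j}` obeying (2.1)–(2.4) with `M`, `R` sufficiently large.

CITATION HEADER (lean-in-tree rule).  Cell `pub-ymgap` (YM Track A, HUMAN RULING D-0062 ∕ D-0149), DAG node N06 = [B9], width seat `pub-ymgap-dag-n06-w4`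
(g0), W-SEAT-START-LIST § n06 ITEM 4 «(γ) `B9.Thm33Printed` at a curved U₀ at the carrier … the six binders PROVED».  WHY THIS FILE.  The `ℤᵈ` frame of
seat dag-n06-e indexes the [B9] family by `MemberZd d L = (M : ℝ) × ZdIdx d L × ℕ` (HONEST SCOPE (a)–(b) of `B9SupplySockB9P3ZdFrame`: the datum carries
B8's (1.28)∕(1.131) geometry but NOT [B6] (2.1)–(2.2), and «`B9.Thm33Printed` AT THIS INSTANCE is … STRONGER than print at the others»); the (3.35) field of the
frame is GENUINE (`Reg335Zd … (cubeClass396Zd L x) …`), non-degenerate wherever the class is inhabited (`B9SupplySockB9P3ZdInstance.pos_of_reg335_bgZd`,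
`bigBlock_mem_cubeClass396Zd`).  THIS FILE locates how much stronger: for a FIXED datum `i` with bounded `Ω₀` (print's `Ω₀ ⊂ T_η` always is) and every
block parameter `M` with `⌈M⌉` beyond the size of `Ω₀` — members the index contains, and over which the junction's `Thm33Printed` hypothesis and the
∀-member binders quantify («`∀ M ≥ M₃`») — the class is EMPTY, (3.35) is vacuous, and a binder that trades the class for an `α₀`-small conclusion
(`CurvAt`: «(3.69) `(Lʲη)³|Δ′(U₀)A| ≤ c₆₉Mα₀|A|₍₋₁₎` under `Reg335 c35 α₀`, `Mα₀ ≤ a₃`») forces its letter to vanish at EVERY unitary background there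
(let `α₀ → 0`).  Consequence for the live design word (dag-n06-b g16 OFFER «`CurvAtInAk` edition» l.24197 ∕ dag-n06-w2 `curvSmallInAk_DpZd`, 2026-08-27): a
GENUINE curvature letter (`B9Eq369…`'s `Δ′(U₀)`, non-zero at curved `U₀`) can satisfy `CurvAt` only on index maps that tie `M` to the datum's big-block
geometry ((2.1)), or under a datum-side smallness hypothesis (`B8Ineq132.InAk`) instead of the frame's class — which is what the `InAk`-keyed edition does.

WHAT IS PROVED (kernel, 0 sorry; theorems only).
* §1 `side_le_of_boxZd_subset` (a box of side `s ≥ 1` inside a box of side `D` has `s ≤ D`, `d ≥ 1`), ★ `cubeClass396Zd_eq_empty_of_subset_box` (if `Ω₀ ⊆`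
  a box of side `D < ⌈M⌉₊` then `cubeClass396Zd L (M, i, m) = ∅`, `L ≥ 1`), `setOf_inBox_subset_boxZd` + `cubeClass396Zd_eq_empty_of_subset_inBox` (the same for
  a datum whose `Ω₀` is a lattice box `{lo ≤ z ≤ hi}` — the cube member of (1.131), `B8CubeMemberZd.exists_member_cube`).
* §2 ★ `reg335_bgZd_of_cubeClass396Zd_eq_empty` (empty class ⇒ `(bgZd 𝔸 L x).Reg335 c α₀ U` for EVERY `c, α₀, U`), `reg335_bgZd_of_subset_box`.
* §3 ★★ `dp_eq_zero_of_curvAt_of_cubeClass396Zd_eq_empty` — at a member with empty class and `0 < a₃`, `CurvAt (bgZd 𝔸 L) L memZd (ιCfgZd 𝔸 L) ops c35 a₃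
  c69 M i m` implies `(ops M i m).Dp U₀ A (x, μ) = 0` for every unitary `U₀`, every `A ∈ E(Ω₀)` (`OnDom`), every `j ≤ m` and every bond touching `Ω_j`;
  ★★ `dp_eq_zero_of_curvAt_of_subset_box` ∕ `…_of_subset_inBox` (the same from «`Ω₀` in a box of side `< ⌈M⌉₊`» ∕ a box datum).
* §4 (v1.1, append-only) ★★ `ineq_of_thm33Printed_of_subset_box` — the node sentence (γ) `B9.Thm33Printed c35 (geoZd …) (bgZd …) Gp GA` at the FULL `ℤᵈ`
  index yields (3.42)–(3.47) for `Gp x`, `GA x` at EVERY configuration of every box-data member with `M ≥ M₁`, `D < ⌈M⌉₊` (the class being vacuous);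
  ★ `glob_le_of_thm33Printed_of_subset_box` — in particular the (3.47) bounds of the junction's `G(U₀)`-letter at every unitary `U₀` there.

HONEST SCOPE.  (i) A located NEGATIVE about the INDEX of the `ℤᵈ` frame, not about [B9]: print's (3.35) is stated for cube classes of domains that ARE
unions of big `M`-blocks ((2.1)), where the class is never empty; nothing printed is contradicted.  (ii) No letter is refuted here: `CurvAt` at such members
is SATISFIABLE (by `Dp := 0`); the theorem says it is satisfiable ONLY by curvature-blind letters there.  (iii) Recommendation (planner's ∕ binder owner's
call, not this seat's): key the member-local binders' smallness on the datum (`InAk`) or restrict the consumer's index map to members with `⌈M⌉·Lʲ`-blocks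
inside `Ω_j` ((2.1)); the junction theorems are generic in the index map.  (iv) Count-neutral; N05 ∕ N06 NOT discharged; one finite `𝕋⁴` programme at fixed
`ε`, Bałaban as printed; R4 closes only the conditional finite-`𝕋⁴` rung `BalabanLadder.UV` — nothing continuum ∕ ℝ⁴ ∕ OS ∕ mass gap ∕ Clay.  Unit
`pub-ymgap-dag-n06-w4` (g0), 2026-08-27.
-/

noncomputable section

namespace Literature.MathematicalPhysics.QuantumFieldTheory.Balaban1983to89.B9SupplySockB9P3ZdEmptyClass

open B7Prop1Explicit
open B7Prop2Explicit (unitaryUnits)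
open B8Ineq132 (BondTouches)
open B8Eq140Level (SideTouches)
open B8ScaledSupNorm (msup)
open B8LeafModelZd (ZdIdx)
open B8Eq133Hypotheses (reg335Zd_iff)
open B9SupplySockB9P3ZdLetters (OpsZd)
open B9SupplySockB9P3ZdLettersOmega (OnDom)
open B9SupplySockB9P3ZdAt (CurvAt)
open B9SupplySockB9P3ZdFrame

-- `Site` alone could resolve to the torus sites of `Setup.lean`; re-export the `ℤ^d` sites of `B7Prop1Explicit`.
export B7Prop1Explicit (Site)

variable {d : ℕ} {L : ℕ}

/-! ## §1  A bounded `Ω₀` and a big block parameter empty the p. 396 cube class -/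

/-- A box of side `s ≥ 1` contained in a box of side `D` has `s ≤ D` (`d ≥ 1`: compare the top corners in one direction). [folklore] -/
private theorem side_le_of_boxZd_subset (hd : 0 < d) {c c' : Site d} {s D : ℕ} (hs : 0 < s) (h : boxZd c' s ⊆ boxZd c D) : s ≤ D := by
  -- the top corner of the small box
  set z : Site d := fun μ => c' μ + (s : ℤ) - 1 with hz
  have hzμ : ∀ μ, z μ = c' μ + (s : ℤ) - 1 := fun μ => rfl
  have htop : z ∈ boxZd c' s := fun μ => by rw [hzμ]; constructor <;> omega
  have hbot : c' ∈ boxZd c' s := mem_boxZd_self c' hs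
  have h1 := (h htop) ⟨0, hd⟩
  have h2 := (h hbot) ⟨0, hd⟩
  rw [hzμ] at h1
  omega

/-- ★ **A BOUNDED `Ω₀` AND `⌈M⌉` BEYOND ITS SIZE EMPTY THE CUBE CLASS**: if the member's `Ω₀` lies in a box of side `D` and `D < ⌈M⌉₊` (`L ≥ 1`, `d ≥ 1`), then
NO cube of the p. 396 class exists — a class cube of index `j` is a box of side `n·⌈M⌉₊·Lʲ ≥ ⌈M⌉₊` inside `Ω_j ⊆ Ω₀`.  (Print never meets this member: its
`Ω_j` are unions of big `M`-blocks, [B6] (2.1).) [cite: Balaban1985BackgroundPropagators, p.396 (the cube class); Balaban1984PropagatorsII, (2.1) p.224] -/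
theorem cubeClass396Zd_eq_empty_of_subset_box (hd : 0 < d) (hL : 1 ≤ L) (x : MemberZd d L) {c : Site d} {D : ℕ}
    (hΩ : x.i.Ω 0 ⊆ boxZd c D) (hM : D < ⌈x.M⌉₊) : cubeClass396Zd L x = ∅ := by
  ext q
  simp only [Set.mem_empty_iff_false, iff_false]
  intro hq
  obtain ⟨hj, ⟨c', n, hn1, -, -, hcube⟩, hsub, -, -⟩ := hq
  -- the cube sits inside `Ω_j ⊆ Ω₀ ⊆ box c D`
  have hΩj : OmTrunc x q.2 ⊆ x.i.Ω 0 := by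
    rw [omTrunc_of_le x hj]
    -- `Ω_j ⊆ Ω_0` from the nesting `Ω_{j+1} ⊆ Ω_j`
    exact antitone_nat_of_succ_le x.i.hΩ (Nat.zero_le q.2)
  have hside : 0 < n * bigSideZd x.M L q.2 := by
    have hM0 : 0 < ⌈x.M⌉₊ := lt_of_le_of_lt (Nat.zero_le D) hM
    exact Nat.mul_pos hn1 (Nat.mul_pos hM0 (pow_pos hL _))
  have hle : n * bigSideZd x.M L q.2 ≤ D := by
    refine side_le_of_boxZd_subset (c := c) (c' := c') hd hside ?_
    rw [← hcube]
    exact (hsub.trans hΩj).trans hΩ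
  -- but the side is at least `⌈M⌉₊ > D`
  have hge : ⌈x.M⌉₊ ≤ n * bigSideZd x.M L q.2 := by
    have h1 : ⌈x.M⌉₊ ≤ bigSideZd x.M L q.2 := Nat.le_mul_of_pos_right _ (pow_pos hL _)
    exact h1.trans (Nat.le_mul_of_pos_left _ hn1)
  omega

/-- an `InBox lo hi` set (the boxes of the B8 lineage — `B8Eq131Cubes.cube`, the cube member's `Ω₀ = □₀`) lies in the cube `boxZd lo D` for any
`D` exceeding every side `hi_μ − lo_μ`. [cite: Balaban1985RegularSpaces, (1.131) p.99 (the cubes □_j)] -/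
theorem setOf_inBox_subset_boxZd {lo hi : Site d} {D : ℕ} (hD : ∀ μ, hi μ - lo μ < D) :
    {z | B7Prop1Local.InBox lo hi z} ⊆ boxZd lo D := by
  intro z hz μ
  have h := hz μ
  have h' := hD μ
  exact ⟨h.1, by omega⟩

/-- ★ **THE SAME FOR A DATUM WHOSE `Ω₀` IS A LATTICE BOX** `{z | lo ≤ z ≤ hi}` (e.g. dag-n05-c's cube member of (1.131), `Ω₀ = □₀`,
`B8CubeMemberZd.exists_member_cube`): every member `(M, i, m)` with `⌈M⌉₊` above the sides of the box has an EMPTY cube class.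
[cite: Balaban1985BackgroundPropagators, p.396 (the cube class); Balaban1985RegularSpaces, (1.131) p.99] -/
theorem cubeClass396Zd_eq_empty_of_subset_inBox (hd : 0 < d) (hL : 1 ≤ L) (x : MemberZd d L) {lo hi : Site d} {D : ℕ}
    (hΩ : x.i.Ω 0 ⊆ {z | B7Prop1Local.InBox lo hi z}) (hD : ∀ μ, hi μ - lo μ < D) (hM : D < ⌈x.M⌉₊) :
    cubeClass396Zd L x = ∅ :=
  cubeClass396Zd_eq_empty_of_subset_box hd hL x (hΩ.trans (setOf_inBox_subset_boxZd hD)) hM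

/-! ## §2  An empty class makes the frame's (3.35) vacuous -/

variable (𝔸 : Type) [CStarAlgebra 𝔸]

/-- ★ **EMPTY CLASS ⇒ (3.35) HOLDS FOR EVERY CONFIGURATION** at the member (the ∀ over the class ranges over `∅`): for all `c, α₀` and EVERY `U`,
`(bgZd 𝔸 L x).Reg335 c α₀ U`. [cite: Balaban1985BackgroundPropagators, (3.35) p.396 («for an arbitrary cube □ of the described above class»)] -/
theorem reg335_bgZd_of_cubeClass396Zd_eq_empty (x : MemberZd d L) (hx : cubeClass396Zd L x = ∅) (c α₀ : ℝ) (U : CfgZd d 𝔸) :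
    (bgZd 𝔸 L x).Reg335 c α₀ U := by
  rw [reg335_bgZd_iff, reg335Zd_iff]
  intro q hq
  rw [hx] at hq
  exact absurd hq (Set.notMem_empty q)

/-- **… in particular at every member whose `Ω₀` lies in a box of side `< ⌈M⌉₊`.** [cite: Balaban1985BackgroundPropagators, (3.35) p.396, p.396 (the cube class)] -/
theorem reg335_bgZd_of_subset_box (hd : 0 < d) (hL : 1 ≤ L) (x : MemberZd d L) {c₀ : Site d} {D : ℕ} (hΩ : x.i.Ω 0 ⊆ boxZd c₀ D)
    (hM : D < ⌈x.M⌉₊) (c α₀ : ℝ) (U : CfgZd d 𝔸) : (bgZd 𝔸 L x).Reg335 c α₀ U :=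
  reg335_bgZd_of_cubeClass396Zd_eq_empty 𝔸 x (cubeClass396Zd_eq_empty_of_subset_box hd hL x hΩ hM) c α₀ U

/-! ## §3  At such members `CurvAt` is met only by curvature-blind letters -/

/-- elementary: a non-negative real below `K·α₀` for every small `α₀ > 0` (`0 < α₀`, `M·α₀ ≤ a₃`, `a₃ > 0`) is `0`. [folklore] -/
private theorem eq_zero_of_le_mul_small {T K M a₃ : ℝ} (hT : 0 ≤ T) (ha₃ : 0 < a₃)
    (h : ∀ α₀ : ℝ, 0 < α₀ → M * α₀ ≤ a₃ → T ≤ K * α₀) : T = 0 := by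
  by_contra hne
  have hTpos : 0 < T := lt_of_le_of_ne hT (Ne.symm hne)
  -- an admissible ceiling for `α₀`
  obtain ⟨α₁, hα₁, hMα₁⟩ : ∃ α₁ : ℝ, 0 < α₁ ∧ M * α₁ ≤ a₃ := by
    rcases lt_or_ge 0 M with hM | hM
    · exact ⟨a₃ / M, div_pos ha₃ hM, by rw [mul_div_cancel₀ _ hM.ne']⟩
    · exact ⟨1, one_pos, by rw [mul_one]; exact hM.trans ha₃.le⟩
  rcases le_or_gt K 0 with hK | hK
  · have h1 := h α₁ hα₁ hMα₁
    have h2 : K * α₁ ≤ 0 := mul_nonpos_of_nonpos_of_nonneg hK hα₁.le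
    linarith
  · -- take `α₀ = min α₁ (T / (2K))`
    set α₀ := min α₁ (T / (2 * K)) with hα₀
    have hα₀pos : 0 < α₀ := lt_min hα₁ (by positivity)
    have hα₀le : α₀ ≤ α₁ := min_le_left _ _
    have hMα₀ : M * α₀ ≤ a₃ := by
      rcases le_or_gt 0 M with hM | hM
      · exact (mul_le_mul_of_nonneg_left hα₀le hM).trans hMα₁
      · have : M * α₀ ≤ 0 := (mul_neg_of_neg_of_pos hM hα₀pos).le
        exact this.trans ha₃.le
    have hle := h α₀ hα₀pos hMα₀
    have hα₀le' : α₀ ≤ T / (2 * K) := min_le_right _ _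
    have h3 : K * α₀ ≤ K * (T / (2 * K)) := mul_le_mul_of_nonneg_left hα₀le' hK.le
    have h4 : K * (T / (2 * K)) = T / 2 := by
      field_simp
    rw [h4] at h3
    linarith

/-- ★★ **AT A MEMBER WITH EMPTY CUBE CLASS, `CurvAt` FORCES THE CURVATURE LETTER TO VANISH ON `E(Ω₀)` AT EVERY UNITARY BACKGROUND**: if
`cubeClass396Zd L (M, i, m) = ∅` and `0 < a₃`, then `CurvAt (bgZd 𝔸 L) L memZd (ιCfgZd 𝔸 L) ops c35 a₃ c69 M i m` («(3.69): `(Lʲη)³|(Δ′(U₀)A)(b)| ≤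
c₆₉·M·α₀·|A|₍₋₁₎` for `U₀` in the class (3.35) at `α₀`, `Mα₀ ≤ a₃`») implies `(ops M i m).Dp U₀ A (x, μ) = 0` for every unitary `U₀`, every
`A ∈ E(Ω₀)`, every `j ≤ m` and every bond `⟨x, x + e_μ⟩` touching `Ω_j` — the class being vacuous, the bound holds at every `U₀` for every small `α₀`,
so let `α₀ → 0`.  A GENUINE `Δ′(U₀)` (non-zero at curved `U₀`) therefore cannot satisfy `CurvAt` at such members.
[cite: Balaban1985BackgroundPropagators, (3.69) p.404, (3.35) p.396, p.396 (the cube class)] -/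
theorem dp_eq_zero_of_curvAt_of_cubeClass396Zd_eq_empty (hL : 1 ≤ L) (ops : ℝ → ZdIdx d L → ℕ → OpsZd d 𝔸) {c35 a₃ c69 M : ℝ}
    {i : ZdIdx d L} {m : ℕ} (hx : cubeClass396Zd L (memZd M i m) = ∅) (ha₃ : 0 < a₃)
    (h : CurvAt (bgZd 𝔸 L) L memZd (ιCfgZd 𝔸 L) ops c35 a₃ c69 M i m)
    (U₀ : Site d → Fin d → 𝔸ˣ) (hU₀ : ∀ x κ, U₀ x κ ∈ unitaryUnits 𝔸) (A : Site d → Fin d → 𝔸) (hA : OnDom L m i.η i.Ω A)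
    {j : ℕ} (hj : j ≤ m) (x : Site d) (μ : Fin d) (hb : BondTouches (i.Ω j) x μ) :
    (ops M i m).Dp U₀ A x μ = 0 := by
  have hsc : 0 < ((L : ℝ) ^ j * i.η) ^ 3 := pow_pos (mul_pos (pow_pos (by exact_mod_cast hL) j) i.hη) 3
  have hT : ((L : ℝ) ^ j * i.η) ^ 3 * ‖(ops M i m).Dp U₀ A x μ‖ = 0 := by
    refine eq_zero_of_le_mul_small (by positivity) ha₃ (M := M)
      (K := c69 * M * msup L m i.η (-(1 : ℝ)) (fun j (b : Site d × Fin d) => SideTouches (i.Ω j) b.1 b.2) (fun b => A b.1 b.2)) ?_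
    intro α₀ hα₀ hMα₀
    have hreg : (bgZd 𝔸 L (memZd M i m)).Reg335 c35 α₀ (ιCfgZd 𝔸 L M i m U₀ hU₀) :=
      reg335_bgZd_of_cubeClass396Zd_eq_empty 𝔸 (memZd M i m) hx c35 α₀ _
    have := h α₀ U₀ hU₀ hα₀ hMα₀ hreg A hA j hj x μ hb
    linarith
  have := (mul_eq_zero.1 hT).resolve_left hsc.ne'
  exact norm_eq_zero.1 this

/-- ★★ **… in particular at every member whose `Ω₀` lies in a box of side `< ⌈M⌉₊`** (`d ≥ 1`, `L ≥ 1`): there `CurvAt` holds ONLY for letters with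
`Δ′(U₀)A = 0` on `E(Ω₀)` at every unitary `U₀`.  Print ties `M` to the geometry ([B6] (2.1)); the `ℤᵈ` member index does not — so consumers of the
member-local binders must (planner's ∕ owner's word) either restrict the index map or key the smallness on the datum.
[cite: Balaban1985BackgroundPropagators, (3.69) p.404, (3.35) p.396; Balaban1984PropagatorsII, (2.1) p.224] -/
theorem dp_eq_zero_of_curvAt_of_subset_box (hd : 0 < d) (hL : 1 ≤ L) (ops : ℝ → ZdIdx d L → ℕ → OpsZd d 𝔸) {c35 a₃ c69 M : ℝ}
    {i : ZdIdx d L} {m : ℕ} {c₀ : Site d} {D : ℕ} (hΩ : i.Ω 0 ⊆ boxZd c₀ D) (hM : D < ⌈M⌉₊) (ha₃ : 0 < a₃)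
    (h : CurvAt (bgZd 𝔸 L) L memZd (ιCfgZd 𝔸 L) ops c35 a₃ c69 M i m)
    (U₀ : Site d → Fin d → 𝔸ˣ) (hU₀ : ∀ x κ, U₀ x κ ∈ unitaryUnits 𝔸) (A : Site d → Fin d → 𝔸) (hA : OnDom L m i.η i.Ω A)
    {j : ℕ} (hj : j ≤ m) (x : Site d) (μ : Fin d) (hb : BondTouches (i.Ω j) x μ) :
    (ops M i m).Dp U₀ A x μ = 0 :=
  dp_eq_zero_of_curvAt_of_cubeClass396Zd_eq_empty 𝔸 hL ops
    (cubeClass396Zd_eq_empty_of_subset_box hd hL (memZd M i m) hΩ hM) ha₃ h U₀ hU₀ A hA hj x μ hb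

/-- ★★ **… and at every member of a BOX datum (`Ω₀ = {lo ≤ z ≤ hi}`, e.g. the cube member of (1.131)) with `⌈M⌉₊` above the sides.**
[cite: Balaban1985BackgroundPropagators, (3.69) p.404, (3.35) p.396; Balaban1985RegularSpaces, (1.131) p.99] -/
theorem dp_eq_zero_of_curvAt_of_subset_inBox (hd : 0 < d) (hL : 1 ≤ L) (ops : ℝ → ZdIdx d L → ℕ → OpsZd d 𝔸) {c35 a₃ c69 M : ℝ}
    {i : ZdIdx d L} {m : ℕ} {lo hi : Site d} {D : ℕ} (hΩ : i.Ω 0 ⊆ {z | B7Prop1Local.InBox lo hi z}) (hD : ∀ μ, hi μ - lo μ < D)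
    (hM : D < ⌈M⌉₊) (ha₃ : 0 < a₃) (h : CurvAt (bgZd 𝔸 L) L memZd (ιCfgZd 𝔸 L) ops c35 a₃ c69 M i m)
    (U₀ : Site d → Fin d → 𝔸ˣ) (hU₀ : ∀ x κ, U₀ x κ ∈ unitaryUnits 𝔸) (A : Site d → Fin d → 𝔸) (hA : OnDom L m i.η i.Ω A)
    {j : ℕ} (hj : j ≤ m) (x : Site d) (μ : Fin d) (hb : BondTouches (i.Ω j) x μ) :
    (ops M i m).Dp U₀ A x μ = 0 :=
  dp_eq_zero_of_curvAt_of_cubeClass396Zd_eq_empty 𝔸 hL ops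
    (cubeClass396Zd_eq_empty_of_subset_inBox hd hL (memZd M i m) hΩ hD hM) ha₃ h U₀ hU₀ A hA hj x μ hb

/-! ## §4  (v1.1, append-only) What the node sentence (γ) at the FULL `ℤᵈ` index demands at such members: (3.42)–(3.47) at EVERY background -/

/-- ★★ **`B9.Thm33Printed` AT THE FULL `ℤᵈ` INDEX FORCES THEOREM 3.3's CONCLUSIONS AT EVERY UNITARY BACKGROUND** on the box-data members with `⌈M⌉₊` beyond
the box: if the node sentence (γ) holds for kernel families `Gp`, `GA` over the frame `geoZd ∕ bgZd` (as the junction's hypothesis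
`B9.Thm33Printed c35 (geoZd 𝔸 L len) (bgZd 𝔸 L) Gp (GAZdFam 𝔸 L len ops loc)` reads), then with ITS constants `δ₀, B₀, B₀(β), B′₀(ε), B′₀(ε,β)` the blocks
(3.42)+(3.46)+(3.47) and (3.43)–(3.45) hold for `Gp x` and `GA x` at EVERY configuration `U` of every member `x = (M, i, m)` with `M ≥ M₁`, `x.i.Ω 0` in a box
of side `D < ⌈M⌉₊` — the (3.35) hypothesis being vacuous there (§2).  For GENUINE letters (`(GAZdFam …).glob` reads the norms of `ops.Gop U₀ J`) this asks
uniform bounds on `G(U₀)` over ALL rough `U₀`; print asks them only on the class (3.35) of domains built from big blocks ([B6] (2.1)).  A located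
consequence for the (γ) row's index, not a claim about [B9]. [cite: Balaban1985BackgroundPropagators, Thm 3.3 p.399, Thm 3.1 (3.42)–(3.47) pp.397–398, (3.35) p.396; Balaban1984PropagatorsII, (2.1) p.224] -/
theorem ineq_of_thm33Printed_of_subset_box (hd : 0 < d) (hL : 1 ≤ L) {c35 : ℝ} {len : Site d → ℝ}
    {Gp GA : ∀ x : MemberZd d L, B9.KernelFamily (geoZd 𝔸 L len x) (bgZd 𝔸 L x)}
    (h33 : B9.Thm33Printed c35 (geoZd 𝔸 L len) (bgZd 𝔸 L) Gp GA) :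
    ∃ (M₁ δ₀ B₀ : ℝ) (Bβ Bε : ℝ → ℝ) (Bεβ : ℝ → ℝ → ℝ), 0 < M₁ ∧ 0 < δ₀ ∧ 0 < B₀ ∧
      ∀ (x : MemberZd d L) {c₀ : Site d} {D : ℕ}, x.i.Ω 0 ⊆ boxZd c₀ D → D < ⌈x.M⌉₊ → M₁ ≤ x.M →
        ∀ U : CfgZd d 𝔸,
          (B9.Ineq342_346_347 (Gp x) B₀ δ₀ U ∧ B9.Ineq343_345 (Gp x) Bβ Bε Bεβ δ₀ U) ∧
          (B9.Ineq342_346_347 (GA x) B₀ δ₀ U ∧ B9.Ineq343_345 (GA x) Bβ Bε Bεβ δ₀ U) := by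
  obtain ⟨M₁, δ₀, a₀, B₀, Bβ, Bε, Bεβ, hM₁, hδ₀, ha₀, hB₀, H⟩ := h33
  refine ⟨M₁, δ₀, B₀, Bβ, Bε, Bεβ, hM₁, hδ₀, hB₀, fun x c₀ D hΩ hMD hM U => ?_⟩
  have hMpos : 0 < x.M := lt_of_lt_of_le hM₁ hM
  -- the class is empty, so `U` is regular at `α₀ := a₀ ∕ M`
  have hreg : (bgZd 𝔸 L x).Reg335 c35 (a₀ / x.M) U :=
    reg335_bgZd_of_subset_box 𝔸 hd hL x hΩ hMD c35 (a₀ / x.M) U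
  exact H x hM (a₀ / x.M) (div_pos ha₀ hMpos) (le_of_eq (mul_div_cancel₀ a₀ hMpos.ne')) U hreg

/-- ★ **… IN PARTICULAR THE (3.47) GLOBAL BOUNDS OF THE JUNCTION'S `G(U₀)`-LETTER AT EVERY UNITARY `U₀`**: for `GA = GAZdFam 𝔸 L len ops loc` (whose
`glob 0 ∕ 1 ∕ 3` entries ARE the weighted norms of `ops.Gop U₀ J`, its gradient and its covariant Laplacian — `B9SupplySockB9P3ZdInstance.dictGlob_zd`),
the node sentence at the full index yields `glob n U₀ J γ ≤ B₀·|J|_{(γ)}`, `γ ∈ [−4, 4]`, at every box-data member with `M ≥ M₁`, `D < ⌈M⌉₊`, for EVERY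
unitary `U₀` and every `J` — no regularity of `U₀` enters. [cite: Balaban1985BackgroundPropagators, Thm 3.3 p.399, (3.47) p.398, (3.35) p.396] -/
theorem glob_le_of_thm33Printed_of_subset_box (hd : 0 < d) (hL : 1 ≤ L) {c35 : ℝ} {len : Site d → ℝ}
    {Gp : ∀ x : MemberZd d L, B9.KernelFamily (geoZd 𝔸 L len x) (bgZd 𝔸 L x)}
    {ops : ℝ → ZdIdx d L → ℕ → OpsZd d 𝔸} {loc : ∀ x : MemberZd d L, LocalLettersZd 𝔸 L x}
    (h33 : B9.Thm33Printed c35 (geoZd 𝔸 L len) (bgZd 𝔸 L) Gp (GAZdFam 𝔸 L len ops loc)) :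
    ∃ M₁ B₀ : ℝ, 0 < M₁ ∧ 0 < B₀ ∧
      ∀ (M : ℝ) (i : ZdIdx d L) (m : ℕ) {c₀ : Site d} {D : ℕ}, i.Ω 0 ⊆ boxZd c₀ D → D < ⌈M⌉₊ → M₁ ≤ M →
        ∀ (U₀ : Site d → Fin d → 𝔸ˣ) (hU₀ : ∀ x κ, U₀ x κ ∈ unitaryUnits 𝔸) (n : Fin 4) (J : Site d → Fin d → 𝔸) (γ : ℝ),
          -4 ≤ γ → γ ≤ 4 →
          (GAZdFam 𝔸 L len ops loc (memZd M i m)).glob n (ιCfgZd 𝔸 L M i m U₀ hU₀) (ιLocZd 𝔸 L len M i m J) γ ≤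
            B₀ * (geoZd 𝔸 L len (memZd M i m)).wNorm γ (ιLocZd 𝔸 L len M i m J) := by
  obtain ⟨M₁, δ₀, B₀, Bβ, Bε, Bεβ, hM₁, -, hB₀, H⟩ := ineq_of_thm33Printed_of_subset_box 𝔸 hd hL h33
  refine ⟨M₁, B₀, hM₁, hB₀, fun M i m c₀ D hΩ hMD hM U₀ hU₀ n J γ hγ1 hγ2 => ?_⟩
  have h := (H (memZd M i m) hΩ hMD hM (ιCfgZd 𝔸 L M i m U₀ hU₀)).2.1
  exact h.2.2 n _ γ hγ1 hγ2

end Literature.MathematicalPhysics.QuantumFieldTheory.Balaban1983to89.B9SupplySockB9P3ZdEmptyClass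

end
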